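import Summits.Ventures.Crystal3D.Bulk.GapIntruderStar
import Summits.Ventures.Crystal3D.Bulk.GapDegreesSharp
import HarnessLib

/-!
# The R-hole row: at an extremal configuration the shell leaves no empty cap larger than the
# hole (DESIGN-L12-THEORY §P-L4 row R-hole = SCORE-DESIGN T2 §16(b))

HONEST FRAMING. Part of the venture `Summits/Ventures/Crystal3D` (cell `pub-crystal3d`, phase 2,
24-hour sprint `PLAN.md` R42/R43; seat typer-bulk-2). One more row of the structure the GAP
census (`Bulk/GapCensusSkeleton.lean`, hypothesis `GapCensus.Complete`) may impose on the
configurations it must kill, proved here for EVERY extremal configuration (`IsExtremal`,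
`Bulk/GapExtremal.lean`: admissible and minimising the intruder distance `D = intruderDist`):

* **`IsExtremal.exists_half_intruderDist_le_inner`** — for every unit vector `q` some shell
  direction `c j − c 0` has `⟪q, c j − c 0⟫ ≥ D/2`; in angular words, every point of the sphere
  is within the hole radius `ρ* = arccos (D/2)` of some shell direction: the twelve shell
  directions leave NO EMPTY CAP OF RADIUS `> ρ*` ("every empty circumcap of `X ∪ {p}` has radius
  `≤ ρ*`", the LP row R-hole of the cell's `phase2/ENV-CENSUS/DESIGN-L12-THEORY.md` §P-L4 /
  `TARGET-GAP.md` §4.5, which kills near-regular `x`-pentagons and fat `p`-faces). Proof: if all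
  twelve inner products with `q` were `< D/2`, put the intruder at `c 0 + D′ q` with
  `D′ = max 1 (2 max_j ⟪q, c j − c 0⟫) < D`: still admissible (`isGapConfig_update_intruder_of_le`:
  `‖D′q − u_j‖² = D′² − 2D′⟪q, u_j⟫ + 1 ≥ 1`), contradicting minimality of `D`.
* `IsExtremal.not_exists_emptyCap` — the same as a non-existence statement, and
  `IsReducedExtremal.exists_half_intruderDist_le_inner` for the reduced extremal configurations
  of the census (`Bulk/GapExtremal.lean`).

Nothing is claimed about GAP(1.26).
-/

noncomputable section

open scoped BigOperators InnerProductSpace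
open Finset

namespace Summit.Ventures.Crystal3D

variable {c : Fin 14 → EuclideanSpace ℝ (Fin 3)}

/-- Squared distance from a point `c 0 + D′ • y` on the ray of a unit vector `y` to a shell ball:
`‖D′ y − (c j − c 0)‖² = D′² − 2 D′ ⟪y, c j − c 0⟫ + 1`. -/
theorem IsGapConfig.dist_sq_ray_shell (hc : IsGapConfig c) {y : EuclideanSpace ℝ (Fin 3)}
    (hy : ‖y‖ = 1) (D' : ℝ) {j : Fin 14} (hj0 : j ≠ 0) (hj13 : j ≠ 13) :
    dist (c 0 + D' • y) (c j) ^ 2 = D' ^ 2 - 2 * D' * ⟪y, c j - c 0⟫_ℝ + 1 := by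
  have hu := hc.norm_sub_eq_one hj0 hj13
  have e : c 0 + D' • y - c j = D' • y - (c j - c 0) := by abel
  rw [dist_eq_norm, e, norm_sub_sq_real, norm_smul, Real.norm_eq_abs, hy, mul_one, sq_abs, hu,
    real_inner_smul_left]
  ring

/-- **Moving the intruder along a ray.** If `y` is a unit vector, `D′ ≥ 1`, and the point
`c 0 + D′ • y` is at distance `≥ 1` from every shell ball of an admissible configuration, then
replacing the intruder by that point gives an admissible configuration with intruder distance
`D′`. (Companion of `isGapConfig_update_intruder` of `Bulk/GapIntruderStar.lean`, which keeps the
distance `D` and asks strict clearance.) -/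
theorem isGapConfig_update_intruder_of_le (hc : IsGapConfig c) {y : EuclideanSpace ℝ (Fin 3)}
    (hy : ‖y‖ = 1) {D' : ℝ} (hD' : 1 ≤ D')
    (hfar : ∀ j : Fin 14, j ≠ 0 → j ≠ 13 → 1 ≤ dist (c 0 + D' • y) (c j)) :
    IsGapConfig (Function.update c 13 (c 0 + D' • y)) ∧
      intruderDist (Function.update c 13 (c 0 + D' • y)) = D' := by
  have hd0 : dist (c 0 + D' • y) (c 0) = D' := by
    rw [dist_eq_norm, add_sub_cancel_left, norm_smul, hy, mul_one,
      Real.norm_of_nonneg (by linarith)]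
  refine ⟨⟨fun a b hab => ?_, fun a ha0 ha13 => ?_⟩, ?_⟩
  · by_cases ha : a = 13
    · subst ha
      rw [Function.update_self, Function.update_of_ne (Ne.symm hab)]
      by_cases hb0 : b = 0
      · rw [hb0, hd0]; exact hD'
      · exact hfar b hb0 (Ne.symm hab)
    by_cases hb : b = 13
    · subst hb
      rw [Function.update_self, Function.update_of_ne ha, dist_comm]
      by_cases ha0 : a = 0
      · rw [ha0, hd0]; exact hD'
      · exact hfar a ha0 ha
    rw [Function.update_of_ne ha, Function.update_of_ne hb]
    exact hc.1 a b hab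
  · rw [Function.update_of_ne ha13, Function.update_of_ne (show (0 : Fin 14) ≠ 13 by decide)]
    exact hc.2 a ha0 ha13
  · unfold intruderDist
    rw [Function.update_of_ne (show (0 : Fin 14) ≠ 13 by decide), Function.update_self,
      dist_comm]
    exact hd0

/-- **The R-hole row: at an extremal configuration the shell directions leave no empty cap of
radius larger than the hole radius.** If `c` is extremal (admissible, minimal intruder distance
`D`) then for every unit vector `q` some shell direction `c j − c 0` satisfies
`D/2 ≤ ⟪q, c j − c 0⟫` — every point of the sphere is within angular distance
`ρ* = arccos (D/2)` of a shell direction; equivalently every empty circumcap of the shell (and of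
shell ∪ hole direction) has radius `≤ ρ*`. Otherwise the intruder could be placed at
`c 0 + D′ q` with `D′ = max 1 (2 maxⱼ ⟪q, c j − c 0⟫) < D`. (Cell files DESIGN-L12-THEORY §P-L4
row R-hole, SCORE-DESIGN T2 §16(b), TARGET-GAP §4.5.) -/
theorem IsExtremal.exists_half_intruderDist_le_inner (hc : IsExtremal c)
    {q : EuclideanSpace ℝ (Fin 3)} (hq : ‖q‖ = 1) :
    ∃ j : Fin 14, j ≠ 0 ∧ j ≠ 13 ∧ intruderDist c / 2 ≤ ⟪q, c j - c 0⟫_ℝ := by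
  classical
  by_contra h
  push Not at h
  set D := intruderDist c with hDdef
  have hD1 : 1 < D := hc.1.one_lt_intruderDist
  -- the shell ball best aligned with `q`
  obtain ⟨j₀, hj₀, hmax⟩ := exists_max_image (univ.filter fun j : Fin 14 => j ≠ 0 ∧ j ≠ 13)
    (fun j => ⟪q, c j - c 0⟫_ℝ) ⟨1, by simp⟩
  simp only [mem_filter, mem_univ, true_and] at hj₀ hmax
  set m := ⟪q, c j₀ - c 0⟫_ℝ with hmdef
  set D' := max 1 (2 * m) with hD'def
  have hm : m < D / 2 := h j₀ hj₀.1 hj₀.2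
  have hD'D : D' < D := max_lt hD1 (by linarith)
  have hD'1 : 1 ≤ D' := le_max_left _ _
  have hfar : ∀ j : Fin 14, j ≠ 0 → j ≠ 13 → 1 ≤ dist (c 0 + D' • q) (c j) := by
    intro j hj0 hj13
    have hle : ⟪q, c j - c 0⟫_ℝ ≤ m := hmax j ⟨hj0, hj13⟩
    have h2m : 2 * m ≤ D' := le_max_right _ _
    have hsq := hc.1.dist_sq_ray_shell hq D' hj0 hj13
    have h1 : 1 ≤ dist (c 0 + D' • q) (c j) ^ 2 := by
      rw [hsq]
      nlinarith [mul_le_mul_of_nonneg_left (show 2 * ⟪q, c j - c 0⟫_ℝ ≤ D' by linarith)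
        (by linarith : (0 : ℝ) ≤ D')]
    have := (one_le_sq_iff_one_le_abs _).1 h1
    rwa [abs_of_nonneg dist_nonneg] at this
  obtain ⟨hadm, hdist⟩ := isGapConfig_update_intruder_of_le hc.1 hq hD'1 hfar
  have hmin := hc.2 _ hadm
  rw [hdist] at hmin
  linarith

/-- **R-hole row, non-existence form**: at an extremal configuration there is no direction `q`
farther than the hole radius from ALL twelve shell directions (no empty cap of radius `> ρ*`).
-/
theorem IsExtremal.not_exists_emptyCap (hc : IsExtremal c) :
    ¬ ∃ q : EuclideanSpace ℝ (Fin 3), ‖q‖ = 1 ∧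
      ∀ j : Fin 14, j ≠ 0 → j ≠ 13 → ⟪q, c j - c 0⟫_ℝ < intruderDist c / 2 := by
  rintro ⟨q, hq, h⟩
  obtain ⟨j, hj0, hj13, hle⟩ := hc.exists_half_intruderDist_le_inner hq
  exact absurd (h j hj0 hj13) (not_lt.2 hle)

/-- **R-hole row at the reduced extremal configurations of the census** (`IsReducedExtremal`,
`Bulk/GapExtremal.lean`): for every unit `q` some shell direction has `⟪q, c j − c 0⟫ ≥ D/2`. -/
theorem IsReducedExtremal.exists_half_intruderDist_le_inner (hc : IsReducedExtremal c)
    {q : EuclideanSpace ℝ (Fin 3)} (hq : ‖q‖ = 1) :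
    ∃ j : Fin 14, j ≠ 0 ∧ j ≠ 13 ∧ intruderDist c / 2 ≤ ⟪q, c j - c 0⟫_ℝ :=
  hc.1.exists_half_intruderDist_le_inner hq

/-- **The hole direction is a deepest hole.** At an extremal configuration the hole direction
`p = ‖c 13 − c 0‖⁻¹ • (c 13 − c 0)` realises the covering radius of the shell: every unit `q` has
some shell direction at inner product `≥ D/2` with it (R-hole row), while `p` itself has ALL
shell directions at inner product `≤ D/2` (`IsGapConfig.inner_dir_intruder_le`) — so
`maxⱼ ⟪q, uⱼ⟫ ≥ D/2 ≥ maxⱼ ⟪p, uⱼ⟫` for every unit `q`. -/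
theorem IsExtremal.exists_inner_le_inner (hc : IsExtremal c) {q : EuclideanSpace ℝ (Fin 3)}
    (hq : ‖q‖ = 1) : ∃ j : Fin 14, j ≠ 0 ∧ j ≠ 13 ∧ ∀ k : Fin 14, k ≠ 0 → k ≠ 13 →
      ⟪c k - c 0, ‖c 13 - c 0‖⁻¹ • (c 13 - c 0)⟫_ℝ ≤ ⟪q, c j - c 0⟫_ℝ := by
  obtain ⟨j, hj0, hj13, hle⟩ := hc.exists_half_intruderDist_le_inner hq
  exact ⟨j, hj0, hj13, fun k hk0 hk13 => (hc.1.inner_dir_intruder_le hk0 hk13).trans hle⟩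

end Summit.Ventures.Crystal3D
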